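import Mathlib
import Summits.Ventures.PercRepro2.Defs
import Summits.Ventures.PercRepro2.Harris
import Summits.Ventures.PercRepro2.Graph
import Summits.Ventures.PercRepro2.Induced
import Summits.Ventures.PercRepro2.VdBKahn

/-!
# The Reimer form of the van den Berg–Kahn inequality: statement, and the disjoint-avoidance case
(blind cell PercRepro2, mine-c g43; `conjectures/MINE-C.md` §52)

A 2-colouring of the edges is a configuration `ω` (world 1 = the open edges of `ω`) together with
its complement `compl ω` (world 2).  For a root `s` and vertex sets `A, X, B, Y` let

  `reimerCount ends s A X B Y = #{ω : ω ∈ Q_A ∩ R_X and compl ω ∈ Q_B ∩ R_Y}`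

(`Q_A = connAll ends s A = {s ↔ a ∀ a ∈ A}`, `R_X = avoidAll ends s X = {s ↮ x ∀ x ∈ X}`).  The
**Reimer form of van den Berg–Kahn, Theorem 1.2** (`conjectures/MINE-C.md` §52; the
coefficientwise version of `vdBK` in the edge odds, exactly as Reimer's inequality
`|𝒜 ∩ ℬ̄| ≥ |𝒜 □ ℬ|` is the coefficientwise version of BK) is

  **(R-1.2)**  `reimerCount A X B Y ≤ reimerCount (A ∪ B) (X ∩ Y) ∅ (X ∪ Y)`   (`RvdBK`),

for every finite multigraph (`ends : E → Sym2 V` is arbitrary, so parallel edges are allowed —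
every minor of the Reimer fibre is again such a graph).  Its case `A = {b}, B = {v}, X = Y = {a₂}`
is the bracket `Q₁ ≥ 0` of the tensor-Bernstein form of the lemma of record
(`MINE-C.md` §51.1, `proofs/MINEC-TBERN.md` §4).  It is NOT proved here in general: the census of
§52 (every labelled simple graph on ≤ 6 vertices and every multigraph on ≤ 4 vertices with edge
multiplicities ≤ 2, for ALL `A, X, B, Y` — 1,934,917,632 instances on 6 vertices alone) has
0 violations, and the planted controls fire.

What IS proved: exactly as the classical proof of `vdBK` is Harris twice when `X ∩ Y = ∅`, the Reimer
form is Harris three times at `p = 1/2` when `X ∩ Y = ∅` (`rvdBK_of_disjoint`) — the whole content of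
`(R-1.2)` sits in the conditioning set `Z = X ∩ Y`, and there the classical exploration of `Z` does
not transfer (`MINE-C.md` §52.2).  The world-2 image `bar A = {ω | compl ω ∈ A}` of an upper set is a
lower set, the counting measure is the product measure at `p = 1/2`, and `bar` preserves counts.
-/

namespace Summit.Ventures.PercRepro2

namespace ReimerVdBK

open Classical

variable {V : Type*} {E : Type*} [Fintype E] [DecidableEq E] [Fintype V] [DecidableEq V]

/-! ## World 2: the complementary configuration -/

/-- The complementary configuration: world 2 of the 2-colouring `ω`. -/
def compl (ω : Config E) : Config E := fun e => !ω e

omit [Fintype E] [DecidableEq E] in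
/-- `compl` is an involution. -/
@[simp] lemma compl_compl (ω : Config E) : compl (compl ω) = ω := by
  funext e; simp [compl]

omit [Fintype E] [DecidableEq E] in
/-- `compl` reverses the configuration order. -/
lemma compl_le_compl {ω ω' : Config E} (h : ω ≤ ω') : compl ω' ≤ compl ω := by
  intro e
  have he : ω e ≤ ω' e := h e
  simp only [compl]
  cases hω : ω e <;> cases hω' : ω' e <;> simp_all

/-- `compl` as a permutation of the configurations. -/
def complEquiv : Config E ≃ Config E where
  toFun := compl
  invFun := compl
  left_inv := compl_compl
  right_inv := compl_compl

/-- The world-2 image of an event: `bar A = {ω | compl ω ∈ A}`. -/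
def bar (A : Set (Config E)) : Set (Config E) := {ω | compl ω ∈ A}

omit [Fintype E] [DecidableEq E] in
/-- Membership in the world-2 image. -/
@[simp] lemma mem_bar {A : Set (Config E)} {ω : Config E} : ω ∈ bar A ↔ compl ω ∈ A := Iff.rfl

omit [Fintype E] [DecidableEq E] in
/-- `bar` is an involution. -/
@[simp] lemma bar_bar (A : Set (Config E)) : bar (bar A) = A := by
  ext ω; simp [bar]

omit [Fintype E] [DecidableEq E] in
/-- `bar` distributes over intersections. -/
lemma bar_inter (A B : Set (Config E)) : bar (A ∩ B) = bar A ∩ bar B := by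
  ext ω; simp [bar]

omit [Fintype E] [DecidableEq E] in
/-- `bar` of the sure event. -/
@[simp] lemma bar_univ : bar (Set.univ : Set (Config E)) = Set.univ := by
  ext ω; simp [bar]

omit [Fintype E] [DecidableEq E] in
/-- The world-2 image of an increasing event is decreasing. -/
lemma isLowerSet_bar_of_isUpperSet {A : Set (Config E)} (hA : IsUpperSet A) :
    IsLowerSet (bar A) := by
  intro ω ω' h hω
  exact hA (compl_le_compl h) hω

omit [Fintype E] [DecidableEq E] in
/-- The world-2 image of a decreasing event is increasing. -/
lemma isUpperSet_bar_of_isLowerSet {A : Set (Config E)} (hA : IsLowerSet A) :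
    IsUpperSet (bar A) := by
  intro ω ω' h hω
  exact hA (compl_le_compl h) hω

/-! ## Counting configurations -/

/-- The number of configurations in an event. -/
noncomputable def count (A : Set (Config E)) : ℕ := ∑ ω : Config E, if ω ∈ A then 1 else 0

/-- Counting is monotone. -/
lemma count_mono {A B : Set (Config E)} (h : A ⊆ B) : count A ≤ count B := by
  unfold count
  refine Finset.sum_le_sum fun ω _ => ?_
  by_cases hω : ω ∈ A
  · simp [hω, h hω]
  · simp [hω]

/-- `bar` preserves counts (`compl` is an involution). -/
lemma count_bar (A : Set (Config E)) : count (bar A) = count A := by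
  unfold count
  exact Fintype.sum_equiv complEquiv _ _ fun ω => by simp [complEquiv, bar]

/-! ## The uniform measure: `prob` at `p = 1/2` is the normalised count -/

/-- The fair weight vector. -/
noncomputable def half : E → ℚ := fun _ => 1 / 2

omit [Fintype E] [DecidableEq E] in
/-- The fair weight vector is admissible. -/
lemma isProbVec_half : IsProbVec (half (E := E)) :=
  ⟨fun _ => by norm_num [half], fun _ => by norm_num [half]⟩

omit [DecidableEq E] in
/-- At `p = 1/2` every configuration has weight `2^{-|E|}`. -/
lemma weight_half (ω : Config E) : weight half ω = (1 / 2 : ℚ) ^ Fintype.card E := by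
  unfold weight
  have hf : ∀ e, edgeFactor (half e) (ω e) = (1 / 2 : ℚ) := fun e => by
    cases ω e <;> simp [half, edgeFactor]
    norm_num
  simp only [hf, Finset.prod_const, Finset.card_univ]

/-- At `p = 1/2` the probability of an event is its count over `2^|E|`. -/
lemma prob_half_eq (A : Set (Config E)) :
    prob half A = (count A : ℚ) * (1 / 2 : ℚ) ^ Fintype.card E := by
  unfold prob count
  push_cast
  rw [Finset.sum_mul]
  refine Finset.sum_congr rfl fun ω _ => ?_
  rw [Set.indicator_apply, weight_half]
  split_ifs <;> simp

/-- Counts compare exactly as probabilities at `p = 1/2` do. -/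
lemma count_le_count_of_prob_half_le {A B : Set (Config E)} (h : prob half A ≤ prob half B) :
    count A ≤ count B := by
  rw [prob_half_eq, prob_half_eq] at h
  have hpos : (0 : ℚ) < (1 / 2 : ℚ) ^ Fintype.card E := by positivity
  exact_mod_cast le_of_mul_le_mul_right h hpos

/-! ## The events and the Reimer count -/

variable (ends : E → Sym2 V) (s : V)

omit [Fintype E] [DecidableEq E] [Fintype V] [DecidableEq V] in
/-- `Q_A` is increasing. -/
lemma isUpperSet_connAll (A : Finset V) : IsUpperSet (connAll ends s A) := by
  intro ω ω' h hω a ha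
  exact conn_mono h (hω a ha)

omit [Fintype E] [DecidableEq E] [Fintype V] [DecidableEq V] in
/-- `R_X` is decreasing. -/
lemma isLowerSet_avoidAll (X : Finset V) : IsLowerSet (avoidAll ends s X) := by
  intro ω ω' h hω x hx hc
  exact hω x hx (conn_mono h hc)

omit [Fintype E] [DecidableEq E] [Fintype V] in
/-- `Q_{A ∪ B} = Q_A ∩ Q_B`. -/
lemma connAll_union (A B : Finset V) :
    connAll ends s (A ∪ B) = connAll ends s A ∩ connAll ends s B := by
  ext ω
  simp only [connAll, Set.mem_setOf_eq, Set.mem_inter_iff, Finset.mem_union]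
  exact ⟨fun h => ⟨fun a ha => h a (Or.inl ha), fun a ha => h a (Or.inr ha)⟩,
    fun h a ha => ha.elim (h.1 a) (h.2 a)⟩

omit [Fintype E] [DecidableEq E] [Fintype V] in
/-- `R_{X ∪ Y} = R_X ∩ R_Y`. -/
lemma avoidAll_union (X Y : Finset V) :
    avoidAll ends s (X ∪ Y) = avoidAll ends s X ∩ avoidAll ends s Y := by
  ext ω
  simp only [avoidAll, Set.mem_setOf_eq, Set.mem_inter_iff, Finset.mem_union]
  exact ⟨fun h => ⟨fun x hx => h x (Or.inl hx), fun x hx => h x (Or.inr hx)⟩,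
    fun h x hx => hx.elim (h.1 x) (h.2 x)⟩

omit [Fintype E] [DecidableEq E] [Fintype V] [DecidableEq V] in
/-- `Q_∅` is the sure event. -/
@[simp] lemma connAll_empty : connAll ends s (∅ : Finset V) = Set.univ := by
  ext ω; simp [connAll]

omit [Fintype E] [DecidableEq E] [Fintype V] [DecidableEq V] in
/-- `R_∅` is the sure event. -/
@[simp] lemma avoidAll_empty : avoidAll ends s (∅ : Finset V) = Set.univ := by
  ext ω; simp [avoidAll]

/-- The two-world event `{ω : ω ∈ Q_A ∩ R_X, compl ω ∈ Q_B ∩ R_Y}`. -/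
def twoWorld (A X B Y : Finset V) : Set (Config E) :=
  (connAll ends s A ∩ avoidAll ends s X) ∩ bar (connAll ends s B ∩ avoidAll ends s Y)

/-- The Reimer count `Φ(A, X; B, Y)`: the number of 2-colourings whose world 1 connects `s` to `A`
and avoids `X` while world 2 connects `s` to `B` and avoids `Y`. -/
noncomputable def reimerCount (A X B Y : Finset V) : ℕ := count (twoWorld ends s A X B Y)

/-- **(R-1.2), the Reimer form of van den Berg–Kahn Theorem 1.2** (conjecture, `MINE-C.md` §52):
`Φ(A, X; B, Y) ≤ Φ(A ∪ B, X ∩ Y; ∅, X ∪ Y)`.  Its case `A = {b}`, `B = {v}`, `X = Y = {a₂}` is the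
coefficientwise non-negativity of the bracket `Q₁` of the tensor-Bernstein form of `(K′)`. -/
def RvdBK (A X B Y : Finset V) : Prop :=
  reimerCount ends s A X B Y ≤ reimerCount ends s (A ∪ B) (X ∩ Y) ∅ (X ∪ Y)

/-! ## The disjoint-avoidance case is Harris three times at `p = 1/2` -/

/-- **Harris at `p = 1/2`, mixed form**: `count (L ∩ U) · 2^|E| ≤ count L · count U` for a lower set
`L` and an upper set `U`; stated as the inequality of the three counts. -/
lemma count_inter_le_of_isLowerSet {L U : Set (Config E)} (hL : IsLowerSet L) (hU : IsUpperSet U) :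
    (count (L ∩ U) : ℚ) * (1 / 2 : ℚ) ^ Fintype.card E ≤ (count L : ℚ) * (count U : ℚ) *
      ((1 / 2 : ℚ) ^ Fintype.card E) ^ 2 := by
  have h := prob_inter_le_prob_mul_prob_of_isLowerSet isProbVec_half hL hU
  rw [prob_half_eq, prob_half_eq, prob_half_eq] at h
  linear_combination h

/-- **Harris at `p = 1/2`** for two upper sets, in counts. -/
lemma count_mul_count_le_of_isUpperSet {A B : Set (Config E)} (hA : IsUpperSet A)
    (hB : IsUpperSet B) :
    (count A : ℚ) * (count B : ℚ) * ((1 / 2 : ℚ) ^ Fintype.card E) ^ 2 ≤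
      (count (A ∩ B) : ℚ) * (1 / 2 : ℚ) ^ Fintype.card E := by
  have h := prob_mul_prob_le_prob_inter isProbVec_half hA hB
  rw [prob_half_eq, prob_half_eq, prob_half_eq] at h
  linear_combination h

omit [Fintype V] in
/-- **(R-1.2) when the avoided sets are disjoint**: if `X ∩ Y = ∅` then
`Φ(A, X; B, Y) ≤ Φ(A ∪ B, ∅; ∅, X ∪ Y)` — Harris three times at `p = 1/2`:
`W = (Q_A ∩ bar R_Y) ∩ (R_X ∩ bar Q_B)` is (upper) ∩ (lower), so `P(W) ≤ P(Q_A ∩ bar R_Y) P(R_X ∩ bar Q_B)`;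
`bar` preserves counts, so `P(R_X ∩ bar Q_B) = P(bar R_X ∩ Q_B)`; and the two upper sets
`Q_A ∩ bar R_Y`, `Q_B ∩ bar R_X` are positively correlated, their intersection being
`Q_{A ∪ B} ∩ bar R_{X ∪ Y}`. -/
theorem rvdBK_of_disjoint (A X B Y : Finset V) (hXY : X ∩ Y = ∅) : RvdBK ends s A X B Y := by
  unfold RvdBK reimerCount twoWorld
  rw [hXY, avoidAll_empty, connAll_empty, Set.inter_univ, Set.univ_inter]
  -- the four monotone pieces
  set QA := connAll ends s A with hQA
  set QB := connAll ends s B with hQB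
  set RX := avoidAll ends s X with hRX
  set RY := avoidAll ends s Y with hRY
  have hU1 : IsUpperSet (QA ∩ bar RY) :=
    (isUpperSet_connAll ends s A).inter (isUpperSet_bar_of_isLowerSet (isLowerSet_avoidAll ends s Y))
  have hL1 : IsLowerSet (RX ∩ bar QB) :=
    (isLowerSet_avoidAll ends s X).inter (isLowerSet_bar_of_isUpperSet (isUpperSet_connAll ends s B))
  have hU2 : IsUpperSet (QB ∩ bar RX) :=
    (isUpperSet_connAll ends s B).inter (isUpperSet_bar_of_isLowerSet (isLowerSet_avoidAll ends s X))
  -- the left event, regrouped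
  have hW : (QA ∩ RX) ∩ bar (QB ∩ RY) = (RX ∩ bar QB) ∩ (QA ∩ bar RY) := by
    rw [bar_inter]; ext ω; simp only [Set.mem_inter_iff]; tauto
  -- the right event, regrouped
  have hR : connAll ends s (A ∪ B) ∩ bar (avoidAll ends s (X ∪ Y)) =
      (QA ∩ bar RY) ∩ (QB ∩ bar RX) := by
    rw [connAll_union, avoidAll_union, bar_inter]; ext ω; simp only [Set.mem_inter_iff]; tauto
  -- `bar` of the lower piece is the second upper piece
  have hbar : bar (RX ∩ bar QB) = QB ∩ bar RX := by
    rw [bar_inter, bar_bar, Set.inter_comm]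
  rw [hW, hR]
  -- the three Harris steps, in counts
  have h1 := count_inter_le_of_isLowerSet hL1 hU1
  have h2 := count_mul_count_le_of_isUpperSet hU1 hU2
  have h3 : count (RX ∩ bar QB) = count (QB ∩ bar RX) := by rw [← hbar, count_bar]
  have hpos : (0 : ℚ) < (1 / 2 : ℚ) ^ Fintype.card E := by positivity
  have key : (count ((RX ∩ bar QB) ∩ (QA ∩ bar RY)) : ℚ) * (1 / 2 : ℚ) ^ Fintype.card E ≤
      (count ((QA ∩ bar RY) ∩ (QB ∩ bar RX)) : ℚ) * (1 / 2 : ℚ) ^ Fintype.card E := by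
    calc (count ((RX ∩ bar QB) ∩ (QA ∩ bar RY)) : ℚ) * (1 / 2 : ℚ) ^ Fintype.card E
        ≤ (count (RX ∩ bar QB) : ℚ) * (count (QA ∩ bar RY) : ℚ) *
            ((1 / 2 : ℚ) ^ Fintype.card E) ^ 2 := h1
      _ = (count (QA ∩ bar RY) : ℚ) * (count (QB ∩ bar RX) : ℚ) *
            ((1 / 2 : ℚ) ^ Fintype.card E) ^ 2 := by rw [h3]; ring
      _ ≤ (count ((QA ∩ bar RY) ∩ (QB ∩ bar RX)) : ℚ) * (1 / 2 : ℚ) ^ Fintype.card E := h2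
  exact_mod_cast le_of_mul_le_mul_right key hpos

omit [Fintype V] in
/-- The case `X = Y = ∅` of `(R-1.2)`: `#{ω ∈ Q_A, compl ω ∈ Q_B} ≤ #{ω ∈ Q_{A ∪ B}}`. -/
theorem rvdBK_of_empty (A B : Finset V) : RvdBK ends s A ∅ B ∅ :=
  rvdBK_of_disjoint ends s A ∅ B ∅ (Finset.empty_inter ∅)

end ReimerVdBK

end Summit.Ventures.PercRepro2
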